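import Summits.BirchSwinnertonDyer.BirchSwinnertonDyer.Theorems.EisensteinPrimesGoodLatticeBDPValueOfLambdaIdentityAnQ
import HarnessLib

/-!
# Route `EisensteinPrimes`, crux 2 `GoodLatticeBDPValue`, line `halves` v19.1 → v20: the crux BY NAME with the
# `λ`-identity required ONLY UNDER the cotorsion / `μ = 0` facts that the composition already holds

Cell `bsd-eis`, seat `bsd-line-x1-p1` LEAD g4. The v19 composition (`…OfLambdaIdentityAnQ`, p637183) consumes the bare
`λ`-identity `h141lam` of KY Thm. 1.4.1 (iii) for ARBITRARY dual data `DSsub, DSquot`. The V21 index road proves that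
identity from `corank` bookkeeping, which reads `λ = zpCorank` only for finitely generated torsion `Λ`-modules with `μ = 0` —
facts the composition HAS at the point of use (`Thm141TorsionClauses.moduleFinite_isTorsion_muInvariant_eq_zero_of_forall_dualData`
for `𝔛^{Sf}_f`, [PWL-θ]'s `hSsub/hSquot` for the character dual data). This file is the same composition with the WEAKER
hypothesis `h141lamT` = `h141lam` with those nine facts as extra antecedents (`thm151ConclusionLE_of_lambdaT_at`,
`goodLatticeMuLambdaOnTree_of_div_of_le_of_lambdaT_of_anQ`, `goodLatticeBDPValue_of_pub_of_lambdaT_of_le_of_anQ`): the proofs of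
p636387 §1 and p637183 §1–§2 line by line, the identity being invoked after the cotorsion clauses are obtained. CONDITIONAL on the
same named facts as before; nothing booked; no summit statement / BSD / IMC2 proved. Helper `--supports stmt-BirchSwinnertonDyer-19032`.

References: [KellerYin2024] Thm. 1.4.1, proof of Thm. 1.5.1 and Thm. 3.0.8 (arXiv:2402.12781v2); [CastellaGrossiLeeSkinner2022]
proof of Thm. 1.5.1; the V21 road memo `Cruxes/GoodLatticeBDPValue/Lines/halves-imprimLambda-index-road.md`.
-/

set_option linter.dupNamespace false
set_option autoImplicit false

noncomputable section

open scoped Classical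

open PowerSeries WeierstrassCurve NumberField IsDedekindDomain Field Rat.HeightOneSpectrum
  Literature.NumberTheory.EllipticCurves Literature.NumberTheory.EllipticCurves.ModularForms
  Literature.NumberTheory.QuadraticFields Literature.NumberTheory.EllipticCurves.Rank1Residual
  Literature.NumberTheory.EllipticCurves.Castella2018 Literature.NumberTheory.EllipticCurves.KellerYin2024
  Literature.NumberTheory.EllipticCurves.CastellaGrossiLeeSkinner2022 Literature.NumberTheory.GaloisRepresentations
  Literature.NumberTheory.EllipticCurves.GreenbergVatsal2000 Literature.NumberTheory.EllipticCurves.GreenbergSelmer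
  Literature.NumberTheory.EllipticCurves.IwasawaAlgebra Literature.NumberTheory.EllipticCurves.BCGKPST2020
  Literature.NumberTheory.EllipticCurves.Rubin1991 Literature.NumberTheory.EllipticCurves.DeShalit1987
  Literature.NumberTheory.EllipticCurves.Hida2010MuInvariant Literature.NumberTheory.IwasawaTheory
  Literature.NumberTheory.IwasawaTheory.Greenberg2016 Literature.NumberTheory.IwasawaTheory.Greenberg2006
open Summit.BirchSwinnertonDyer.Rank1Residual.X11b.Halves Summit.BirchSwinnertonDyer.Rank1Residual.X1.KellerYinHalves
  Summit.BirchSwinnertonDyer.Rank1Residual.X1.KellerYinMuLambdaSplit Summit.BirchSwinnertonDyer.BirchSwinnertonDyer.Theorems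
  Summit.BirchSwinnertonDyer.Rank1Residual.X1.KellerYinMuLambdaSplitDS
  Summit.BirchSwinnertonDyer.Rank1Residual.X1.KellerYinMuLambdaSplitDSFree
  Summit.BirchSwinnertonDyer.BirchSwinnertonDyer.Theorems.IwasawaTwoVariable
  Summit.BirchSwinnertonDyer.BirchSwinnertonDyer.Theorems.EisensteinPrimesMuLambda
  Summit.BirchSwinnertonDyer.BirchSwinnertonDyer.Theorems.GoodLatticeBDPValueHalves
  Summit.BirchSwinnertonDyer.BirchSwinnertonDyer.Theorems.GoodLatticeBDPValueOfImprimitive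

namespace Summit.BirchSwinnertonDyer.BirchSwinnertonDyer.Theorems.GoodLatticeBDPValueOfLambdaIdentityTors
open Summit.BirchSwinnertonDyer.BirchSwinnertonDyer.Theorems.GoodLatticeBDPValueOfOneInequality
  Summit.BirchSwinnertonDyer.BirchSwinnertonDyer.Theorems.GoodLatticeBDPValueOfLambdaIdentity
  Summit.BirchSwinnertonDyer.BirchSwinnertonDyer.Theorems.GoodLatticeBDPValueOfLambdaIdentityAnQ

/-! ## §1 The pointwise glue with [ALG-imp] cut down to the `λ`-identity -/
/-- **KY Thm. 1.5.1's conclusion AT GIVEN DATA, `≤` form, with [ALG-imp] CUT DOWN TO ITS `λ`-IDENTITY**: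
[RH] at the data + the bare `λ`-identity of KY Thm. 1.4.1 (`h141lam`: binders of
`thm141_imprimlambda_goodLattice_OPEN` VERBATIM, conclusion its LAST conjunct only) + [PWL-θ]
(imprimitive form) + the INEQUALITY `corank_{ℤ_p}(Sel_v̄^{Sf}/Sel_v̄^∅) ≤ Σ_{w∈Sf} λ(𝒫_w(f))` AT THE DATA
⟹ `𝔛_f` is finitely generated `Λ`-torsion with `μ = 0` and
`λ(𝔛_ω̃) + λ(𝔛_𝟙̃) + Σ_w (λ𝒫_w(ω̃) + λ𝒫_w(𝟙̃)) ≤ λ(𝔛_f) + e + Σ_w λ𝒫_w(f)`. The proof of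
`GoodLatticeBDPValueOfOneInequality.thm151ConclusionLE_of_thm141_at` line by line, except that the
cotorsion / `μ = 0` / finite-generation clauses of Thm. 1.4.1 for `𝔛_f^{Sf}` and `𝔛_f` are now the
KERNEL theorem `Thm141TorsionClauses.moduleFinite_isTorsion_muInvariant_eq_zero_of_forall_dualData` fed by
[PWL-θ]'s first clause. CONDITIONAL; nothing booked. [claim: KellerYin2024, status: under-review]
[cite: KellerYin2024, proof of Thm. 1.5.1 (arXiv:2402.12781v2 TeX L1358–1360), Thm. 1.4.1 (L1087–1098)]
[cite: CastellaGrossiLeeSkinner2022, proof of Thm. 1.5.1 (MAINalgside; arXiv:2008.02571v2 TeX L909–931)] -/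
theorem thm151ConclusionLE_of_lambdaT_at
    (h141lamT : ∀ (W : WeierstrassCurve ℚ) [W.IsElliptic] [W.IsGloballyMinimal] (p : ℕ) [Fact p.Prime],
      2 < p → Good W p → Red W p → Anom W p →
      (∀ Φ : AddSubgroup (geomTorsion W (p : ℤ)), IsRationalLine W p Φ → ¬ LineUnramifiedAt W p Φ) →
      ∀ (K : Type) [Field K] [NumberField K], IsImaginaryQuadratic K →
        SatisfiesHeegnerHypothesis (W.conductorNorm ℤ) K → SatisfiesHeegnerHypothesis p K →
        (∀ Q : (W.baseChange K).toAffine.Point, p • Q = 0 → Q = 0) →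
      ∀ (ι : K →+* ℚ_[p]) (v vbar : HeightOneSpectrum (𝓞 K)),
        (∀ x : 𝓞 K, x ∈ v.asIdeal ↔ ‖ι (x : K)‖ < 1) →
        ((p : ℕ) : 𝓞 K) ∈ vbar.asIdeal → vbar ≠ v →
      ∀ (κ : ZpExtension K p), κ.IsAnticyclotomic →
      ∀ (γ : absoluteGaloisGroup K) [Fact (κ.IsTopGenerator γ)],
      ∀ (θsub θquot : FramedGaloisRep K (padicCoeffIntegers (∅ : Set (PadicAlgCl p))) 1),
        IsResidualPairOver (W.baseChange K) p θsub θquot →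
      ∀ (Sf : Finset (HeightOneSpectrum (𝓞 K))),
        (∀ w : HeightOneSpectrum (𝓞 K), w ∈ Sf ↔ ((W.conductorNorm ℤ : ℤ) : 𝓞 K) ∈ w.asIdeal) →
      ∀ (DSsub : DatumDualData κ γ (charModule ∅ θsub)
          (AcSelmer.bdpData (charModule ∅ θsub) p vbar) (↑Sf : Set (HeightOneSpectrum (𝓞 K))))
        (DSquot : DatumDualData κ γ (charModule ∅ θquot)
          (AcSelmer.bdpData (charModule ∅ θquot) p vbar) (↑Sf : Set (HeightOneSpectrum (𝓞 K)))),
      Module.Finite (IwasawaAlgebra p) (AcSelmer.XAc (W.baseChange K) p κ vbar (↑Sf : Set (HeightOneSpectrum (𝓞 K))) γ) →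
      Module.IsTorsion (IwasawaAlgebra p) (AcSelmer.XAc (W.baseChange K) p κ vbar (↑Sf : Set (HeightOneSpectrum (𝓞 K))) γ) →
      muInvariant p (AcSelmer.XAc (W.baseChange K) p κ vbar (↑Sf : Set (HeightOneSpectrum (𝓞 K))) γ) = 0 →
      Module.Finite (IwasawaAlgebra p) DSsub.X → Module.IsTorsion (IwasawaAlgebra p) DSsub.X → muInvariant p DSsub.X = 0 →
      Module.Finite (IwasawaAlgebra p) DSquot.X → Module.IsTorsion (IwasawaAlgebra p) DSquot.X →
        muInvariant p DSquot.X = 0 →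
      lambdaInvariant p (AcSelmer.XAc (W.baseChange K) p κ vbar (↑Sf : Set (HeightOneSpectrum (𝓞 K))) γ) +
          (if ∀ σ : absoluteGaloisGroup K, θquot σ = 1 then 1 else 0) =
        lambdaInvariant p DSsub.X + lambdaInvariant p DSquot.X)
    (h125 : prop125_residualPair_unrSelmer_imprimitive)
    (W : WeierstrassCurve ℚ) [W.IsElliptic] [W.IsGloballyMinimal] (p : ℕ) [Fact p.Prime]
    (hp : 2 < p) (hgood : Good W p) (hred : Red W p) (hanom : Anom W p)
    (hlat : ∀ Φ : AddSubgroup (geomTorsion W (p : ℤ)), IsRationalLine W p Φ → ¬ LineUnramifiedAt W p Φ)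
    (K : Type) [Field K] [NumberField K] (hK : IsImaginaryQuadratic K)
    (hH : SatisfiesHeegnerHypothesis (W.conductorNorm ℤ) K) (hHp : SatisfiesHeegnerHypothesis p K)
    (htor : ∀ Q : (W.baseChange K).toAffine.Point, p • Q = 0 → Q = 0)
    (ι : K →+* ℚ_[p]) (v vbar : HeightOneSpectrum (𝓞 K))
    (hv : ∀ x : 𝓞 K, x ∈ v.asIdeal ↔ ‖ι (x : K)‖ < 1)
    (hvbar : ((p : ℕ) : 𝓞 K) ∈ vbar.asIdeal) (hne : vbar ≠ v)
    (κ : ZpExtension K p) (hκ : κ.IsAnticyclotomic)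
    (γ : absoluteGaloisGroup K) [Fact (κ.IsTopGenerator γ)]
    (θsub θquot : FramedGaloisRep K (padicCoeffIntegers (∅ : Set (PadicAlgCl p))) 1)
    (hpair : IsResidualPairOver (W.baseChange K) p θsub θquot)
    (Sf : Finset (HeightOneSpectrum (𝓞 K)))
    (hSf : ∀ w : HeightOneSpectrum (𝓞 K), w ∈ Sf ↔ ((W.conductorNorm ℤ : ℤ) : 𝓞 K) ∈ w.asIdeal)
    (hRHsub : ∀ D : DatumDualData κ γ (charModule ∅ θsub)
        (AcSelmer.bdpData (charModule ∅ θsub) p vbar) (∅ : Set (HeightOneSpectrum (𝓞 K))),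
      Module.Finite (IwasawaAlgebra p) D.X ∧ Module.IsTorsion (IwasawaAlgebra p) D.X ∧
        muInvariant p D.X = 0)
    (hRHquot : ∀ D : DatumDualData κ γ (charModule ∅ θquot)
        (AcSelmer.bdpData (charModule ∅ θquot) p vbar) (∅ : Set (HeightOneSpectrum (𝓞 K))),
      Module.Finite (IwasawaAlgebra p) D.X ∧ Module.IsTorsion (IwasawaAlgebra p) D.X ∧
        muInvariant p D.X = 0)
    (Dsub : DatumDualData κ γ (charModule ∅ θsub)
        (AcSelmer.bdpData (charModule ∅ θsub) p vbar) ∅)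
    (Dquot : DatumDualData κ γ (charModule ∅ θquot)
        (AcSelmer.bdpData (charModule ∅ θquot) p vbar) ∅)
    (hcf : zpCorank (↥(AcSelmer.selmerAc (W.baseChange K) p κ vbar (↑Sf : Set (HeightOneSpectrum (𝓞 K)))) ⧸
        (AcSelmer.selmerAc (W.baseChange K) p κ vbar (∅ : Set (HeightOneSpectrum (𝓞 K)))).addSubgroupOf
          (AcSelmer.selmerAc (W.baseChange K) p κ vbar (↑Sf : Set (HeightOneSpectrum (𝓞 K))))) p ≤
      ∑ w ∈ Sf, curveLocalLambda κ (W.baseChange K) w) :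
    Module.Finite (IwasawaAlgebra p) (AcSelmer.XAc (W.baseChange K) p κ vbar ∅ γ) ∧
      Module.IsTorsion (IwasawaAlgebra p) (AcSelmer.XAc (W.baseChange K) p κ vbar ∅ γ) ∧
      muInvariant p (AcSelmer.XAc (W.baseChange K) p κ vbar ∅ γ) = 0 ∧
      lambdaInvariant p Dsub.X + lambdaInvariant p Dquot.X +
          ∑ w ∈ Sf, (charLocalLambda ∅ κ θsub w + charLocalLambda ∅ κ θquot w) ≤
        lambdaInvariant p (AcSelmer.XAc (W.baseChange K) p κ vbar ∅ γ) +
          (if ∀ σ : absoluteGaloisGroup K, θquot σ = 1 then 1 else 0) +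
          ∑ w ∈ Sf, curveLocalLambda κ (W.baseChange K) w := by
  have hγ : κ.IsTopGenerator γ := Fact.out
  obtain ⟨DSsub⟩ := nonempty_unrDualData_char (∅ : Set (PadicAlgCl p)) θsub κ vbar
    (↑Sf : Set (HeightOneSpectrum (𝓞 K))) hγ
  obtain ⟨DSquot⟩ := nonempty_unrDualData_char (∅ : Set (PadicAlgCl p)) θquot κ vbar
    (↑Sf : Set (HeightOneSpectrum (𝓞 K))) hγ
  obtain ⟨hSsub, hcsub⟩ := h125 W p hp hgood hred hanom hlat K hK hH hHp htor ι v vbar hv hvbar hne κ hκ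
    γ θsub θquot hpair Sf hSf θsub (Or.inl rfl) hRHsub
  obtain ⟨hSquot, hcquot⟩ := h125 W p hp hgood hred hanom hlat K hK hH hHp htor ι v vbar hv hvbar hne κ
    hκ γ θsub θquot hpair Sf hSf θquot (Or.inr rfl) hRHquot
  -- KY Thm. 1.4.1's cotorsion clauses IN THE KERNEL (residual dévissage, p628626 + this seat's files)
  obtain ⟨⟨hfgS, htorS, hμS⟩, ⟨hfg0, htor0, hμ0⟩⟩ :=
    Thm141TorsionClauses.moduleFinite_isTorsion_muInvariant_eq_zero_of_forall_dualData W hp K hK vbar hvbar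
      κ hκ γ hpair Sf hSf hSsub hSquot
  haveI := hfgS
  obtain ⟨-, -, -, -, hshiftf⟩ :=
    XAcImprimitiveLambdaShift.lambdaInvariant_eq_add_zpCorank_of_muInvariant_eq_zero (W.baseChange K) p
      κ vbar γ (Set.empty_subset (↑Sf : Set (HeightOneSpectrum (𝓞 K)))) htorS hμS
  obtain ⟨hfgSsub, htorSsub, hμSsub⟩ := hSsub DSsub
  obtain ⟨hfgSquot, htorSquot, hμSquot⟩ := hSquot DSquot
  haveI := hfgSsub
  haveI := hfgSquot
  have hlam := h141lamT W p hp hgood hred hanom hlat K hK hH hHp htor ι v vbar hv hvbar hne κ hκ γ θsub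
    θquot hpair Sf hSf DSsub DSquot hfgS htorS hμS hfgSsub htorSsub hμSsub hfgSquot
    htorSquot hμSquot
  obtain ⟨-, -, -, -, hshiftsub⟩ :=
    UnrSelmerImprimitiveLambdaShift.lambdaInvariant_eq_add_zpCorank_of_muInvariant_eq_zero κ vbar
      (exists_pow_smul_cofree_eq_zero (∅ : Set (PadicAlgCl p)) θsub)
      (isOpen_stabilizer_cofree (∅ : Set (PadicAlgCl p)) θsub) hγ
      (Set.empty_subset (↑Sf : Set (HeightOneSpectrum (𝓞 K)))) DSsub htorSsub hμSsub Dsub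
  obtain ⟨-, -, -, -, hshiftquot⟩ :=
    UnrSelmerImprimitiveLambdaShift.lambdaInvariant_eq_add_zpCorank_of_muInvariant_eq_zero κ vbar
      (exists_pow_smul_cofree_eq_zero (∅ : Set (PadicAlgCl p)) θquot)
      (isOpen_stabilizer_cofree (∅ : Set (PadicAlgCl p)) θquot) hγ
      (Set.empty_subset (↑Sf : Set (HeightOneSpectrum (𝓞 K)))) DSquot htorSquot hμSquot Dquot
  refine ⟨hfg0, htor0, hμ0, ?_⟩
  rw [Finset.sum_add_distrib]
  rw [hcsub] at hshiftsub
  rw [hcquot] at hshiftquot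
  generalize (if ∀ σ : absoluteGaloisGroup K, θquot σ = 1 then 1 else 0) = e at hlam ⊢
  generalize zpCorank (↥(AcSelmer.selmerAc (W.baseChange K) p κ vbar
      (↑Sf : Set (HeightOneSpectrum (𝓞 K)))) ⧸
    (AcSelmer.selmerAc (W.baseChange K) p κ vbar (∅ : Set (HeightOneSpectrum (𝓞 K)))).addSubgroupOf
      (AcSelmer.selmerAc (W.baseChange K) p κ vbar (↑Sf : Set (HeightOneSpectrum (𝓞 K))))) p = c
    at hcf hshiftf
  omega

end Summit.BirchSwinnertonDyer.BirchSwinnertonDyer.Theorems.GoodLatticeBDPValueOfLambdaIdentityTors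

end
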